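import Literature.NumberTheory.Sieve.FriedlanderIwaniecPrimesLemma33
import Mathlib.Analysis.Convex.SpecificFunctions.Basic
import HarnessLib

/-!
# Friedlander–Iwaniec, *The polynomial `X² + Y⁴` captures its primes*, Lemma 3.1: counting inputs

Family `parity`, statement parity.S17. Source: J. Friedlander, H. Iwaniec, Ann. of Math. (2) 148
(1998), 945–1040 [FriedlanderIwaniecAnnals1998] (= arXiv:math/9811185), §3, proof of Lemma 3.1
(arXiv pp. 10–13): the elementary counting facts used alongside Poisson summation and Lemma 3.3 —

* the roots of `ν² ≡ 0`: `ρ(0; γδ²) = δ` for `γ` squarefree (`card_fiRoots_zero`), which controls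
  the terms with `b = 0` ("This contribution is `𝔷(0) ∑_{a² ≡ 0 (d)} f(a²) ≪ √x/(d₁d₂)`");
* the root counts under the factorisation (3.9): `ρ(γδℓ'; γδ²d') = δ ρ(ℓ'; d')` and
  `ρ(ℓ'; d') = ρ(d')` for `(d', ℓ') = 1` (`card_fiRoots_factor`, `card_fiRoots_eq_fiRho`);
* **the mean values of `ρ(ℓ; d)/d`** ("`∑_{d ≤ D} d⁻¹ ρ(c²; d) ≪ (log 2D)²`", derived "by the same
  arguments which led us to (3.5)"): `∑_{d ≤ D} ρ(ℓ; d)/d ≤ C τ(ℓ²) (1 + log D)²` for `ℓ ≥ 1`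
  (`sum_card_fiRoots_div_le`, with `C` from `ρ(n) ≤ C τ(n)`) and `∑_{d ≤ D} ρ(0; d)/d ≤ (1 + log D)²`
  (`sum_card_fiRoots_zero_div_le`);
* **the number of lattice points in the strip `x - y < a² + c⁴ ≤ x`** (the count behind (3.10)
  "`∑_{d ≤ D} |A_d(x) - A_d(f)| ≪ y x^{-1/4+ε}`" and (3.12)): at most `4 y x^{-1/4} + 28 √x` for
  `1 ≤ x - y`, `2y ≤ x` (`strip_count_le`, from the tree's `abs_fiCount_sub_le`,
  `|A(x) - 4κx^{3/4}| ≤ 14√x`).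

Everything here is PROVED; no definitions are introduced.

## References

* J. Friedlander, H. Iwaniec, Ann. of Math. (2) 148 (1998), 945–1040, §3, (3.2), (3.4)–(3.5),
  (3.10), (3.12). [cite: FriedlanderIwaniecAnnals1998, §3, proof of Lemma 3.1]

## Mathlib / tree search

Tree: `fiRoots`, `fiRoots_eq_image`, `gcd_eq_mul_sq_iff`, `sum_fiRoots_twist`,
`dvd_of_squarefree_of_mul_sq_dvd_sq`, `sum_range_mul_eq_sum_sum` (`…WeylHarmonics`);
`sum_filter_dvd_Icc`, `exists_fiRho_le_mul_card_divisors` (`…Lemma33`); `fiCount`,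
`abs_fiCount_sub_le`, `sum_fiRepCount_add_one`, `fiDisc`, `friedlanderIwaniecKappa_pos`
(`FriedlanderIwaniecPrimes`). Mathlib: `Nat.sq_mul_squarefree_of_pos`, `harmonic_le_one_add_log`,
`Real.rpow_one_add_le_one_add_mul_self` (Bernoulli).
-/

noncomputable section

open Finset Real

namespace Literature.NumberTheory.Sieve.FriedlanderIwaniecPrimes

/-! ### The roots of `ν² ≡ 0 (mod γδ²)` -/

/-- For `γ` squarefree, `γδ² ∣ ν²` iff `γδ ∣ ν`. [folklore] -/
theorem mul_sq_dvd_sq_iff {γ δ ν : ℕ} (hγ : Squarefree γ) : γ * δ ^ 2 ∣ ν ^ 2 ↔ γ * δ ∣ ν := by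
  refine ⟨dvd_of_squarefree_of_mul_sq_dvd_sq hγ, fun ⟨t, ht⟩ => ⟨γ * t ^ 2, ?_⟩⟩
  rw [ht]; ring

/-- **`ρ(0; γδ²)`: the roots of `ν² ≡ 0 (mod γδ²)` are the multiples of `γδ`** (`γ` squarefree).
[cite: FriedlanderIwaniecAnnals1998, §3, "𝔷(0) ∑_{a² ≡ 0 (d)} f(a²) = 𝔷(0) ∑_a f((a d₁ d₂)²)"] -/
theorem fiRoots_zero_eq {γ δ : ℕ} (hγ : Squarefree γ) (hγ0 : 0 < γ) (hδ : 0 < δ) :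
    fiRoots 0 (γ * δ ^ 2) = (range δ).image fun j => γ * δ * j := by
  have hγδ : 0 < γ * δ := Nat.mul_pos hγ0 hδ
  ext ν
  simp only [mem_fiRoots, mem_image, mem_range, ne_eq, OfNat.ofNat_ne_zero, not_false_eq_true,
    zero_pow, add_zero, mul_sq_dvd_sq_iff hγ]
  constructor
  · rintro ⟨hν, j, rfl⟩
    refine ⟨j, ?_, rfl⟩
    have : γ * δ * j < γ * δ * δ := by rw [mul_assoc γ δ δ, ← sq]; exact hν
    exact Nat.lt_of_mul_lt_mul_left this
  · rintro ⟨j, hj, rfl⟩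
    refine ⟨?_, dvd_mul_right _ _⟩
    calc γ * δ * j < γ * δ * δ := Nat.mul_lt_mul_of_pos_left hj hγδ
      _ = γ * δ ^ 2 := by ring

/-- `ρ(0; γδ²) = δ` for `γ` squarefree. [cite: FriedlanderIwaniecAnnals1998, §3 (3.2) with b = 0] -/
theorem card_fiRoots_zero {γ δ : ℕ} (hγ : Squarefree γ) (hγ0 : 0 < γ) (hδ : 0 < δ) :
    #(fiRoots 0 (γ * δ ^ 2)) = δ := by
  rw [fiRoots_zero_eq hγ hγ0 hδ, card_image_of_injective _ fun a b h =>
    Nat.eq_of_mul_eq_mul_left (Nat.mul_pos hγ0 hδ) h, card_range]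

/-! ### Root counts under the factorisation `d = γδ²d'`, `ℓ = γδℓ'` -/

/-- **`ρ(γδℓ'; γδ²d') = δ ρ(ℓ'; d')`** (`γ` squarefree, `(d', γ) = 1`): by `fiRoots_eq_image` the
roots are `γδμ`, `μ mod δd'` with `d' ∣ μ² + ℓ'²`, and there are `δ` such `μ` above each root
modulo `d'`. [cite: FriedlanderIwaniecAnnals1998, §3 (3.2) and (3.9)] -/
theorem card_fiRoots_factor {γ δ d' ℓ' : ℕ} (hγ : Squarefree γ) (hγ0 : 0 < γ) (hδ : 0 < δ)
    (hcopγ : Nat.Coprime d' γ) :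
    #(fiRoots (γ * δ * ℓ') (γ * δ ^ 2 * d')) = δ * #(fiRoots ℓ' d') := by
  rw [fiRoots_eq_image hγ hγ0 hδ hcopγ, card_image_of_injective _ fun a b h =>
    Nat.eq_of_mul_eq_mul_left (Nat.mul_pos hγ0 hδ) h]
  -- count `μ < δd'` with `d' ∣ μ² + ℓ'²` by splitting `μ = i + d'j`
  rw [card_eq_sum_ones, sum_filter, mul_comm δ d', sum_range_mul_eq_sum_sum]
  have hind : ∀ i j : ℕ, (d' ∣ (i + d' * j) ^ 2 + ℓ' ^ 2 ↔ d' ∣ i ^ 2 + ℓ' ^ 2) := by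
    intro i j
    rw [show (i + d' * j) ^ 2 + ℓ' ^ 2 = i ^ 2 + ℓ' ^ 2 + d' * (2 * i * j + d' * j ^ 2) by ring]
    exact Nat.dvd_add_left (dvd_mul_right d' _)
  simp_rw [if_congr (hind _ _) rfl rfl]
  rw [sum_const, card_range, smul_eq_mul, ← sum_filter, ← card_eq_sum_ones]
  rfl

/-- **`ρ(ℓ'; d') = ρ(d')` for `(d', ℓ') = 1`** (the twist `μ ↦ ℓ'ω`, `sum_fiRoots_twist` at frequency
`0`). [cite: FriedlanderIwaniecAnnals1998, §3 (3.2)] -/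
theorem card_fiRoots_eq_fiRho {d' ℓ' : ℕ} (hd' : 0 < d') (hcop : Nat.Coprime d' ℓ') :
    #(fiRoots ℓ' d') = fiRho d' := by
  have h := sum_fiRoots_twist hd' hcop 0
  simp only [Nat.cast_zero, mul_zero, zero_mul, zero_div, LargeSieve.e_zero, sum_const,
    nsmul_eq_mul, mul_one, Nat.cast_inj] at h
  rw [h, card_fiRoots_one]

/-! ### Harmonic sums -/

/-- `0 ≤ 1 + log D` for a natural number `D`. [folklore] -/
theorem one_add_log_nonneg (D : ℕ) : 0 ≤ 1 + Real.log D := by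
  rcases Nat.eq_zero_or_pos D with rfl | hD
  · simp
  · have : 0 ≤ Real.log D := Real.log_nonneg (by exact_mod_cast hD)
    linarith

/-- `∑_{d ≤ D} τ(d)/d ≤ (1 + log D)²` (`τ(d)/d = ∑_{em = d} 1/(em)`). [folklore] -/
theorem sum_card_divisors_div_le (D : ℕ) :
    ∑ d ∈ Icc 1 D, (#d.divisors : ℝ) / d ≤ (1 + Real.log D) ^ 2 := by
  have hH : ∑ m ∈ Icc 1 D, (m : ℝ)⁻¹ ≤ 1 + Real.log D := (by
    have h : ∑ m ∈ Icc 1 D, (m : ℝ)⁻¹ = (harmonic D : ℝ) := by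
      rw [harmonic_eq_sum_Icc]; push_cast; rfl
    rw [h]; exact harmonic_le_one_add_log D)
  have hH0 : 0 ≤ ∑ m ∈ Icc 1 D, (m : ℝ)⁻¹ := sum_nonneg fun _ _ => by positivity
  calc ∑ d ∈ Icc 1 D, (#d.divisors : ℝ) / d
      = ∑ d ∈ Icc 1 D, ∑ e ∈ d.divisors, (d : ℝ)⁻¹ := by
        refine sum_congr rfl fun d _ => ?_
        rw [sum_const, nsmul_eq_mul, div_eq_mul_inv]
    _ = ∑ e ∈ Icc 1 D, ∑ m ∈ Icc 1 (D / e), ((e * m : ℕ) : ℝ)⁻¹ :=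
        sum_Icc_sum_divisors_eq D (fun _ d => (d : ℝ)⁻¹)
    _ ≤ ∑ e ∈ Icc 1 D, ∑ m ∈ Icc 1 D, ((e : ℝ)⁻¹ * (m : ℝ)⁻¹) := by
        refine sum_le_sum fun e _ => ?_
        refine (sum_le_sum_of_subset_of_nonneg (Icc_subset_Icc_right (Nat.div_le_self _ _))
          fun _ _ _ => by positivity).trans (le_of_eq (sum_congr rfl fun m _ => ?_))
        push_cast
        rw [mul_inv]
    _ = (∑ m ∈ Icc 1 D, (m : ℝ)⁻¹) ^ 2 := by rw [sq, sum_mul_sum]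
    _ ≤ (1 + Real.log D) ^ 2 := pow_le_pow_left₀ hH0 hH 2

/-! ### The mean values of `ρ(ℓ; d)/d` over `d ≤ D` -/

/-- **`∑_{d ≤ D} ρ(0; d)/d ≤ (1 + log D)²`**: writing `d = γδ²` with `γ` squarefree,
`ρ(0; d)/d = 1/(γδ)`, and `∑_{γδ² ≤ D} 1/(γδ) ≤ (∑_{m ≤ D} 1/m)²`.
[cite: FriedlanderIwaniecAnnals1998, §3, "≪ √x/(d₁d₂)" summed over d ≤ D] -/
theorem sum_card_fiRoots_zero_div_le (D : ℕ) :
    ∑ d ∈ Icc 1 D, (#(fiRoots 0 d) : ℝ) / d ≤ (1 + Real.log D) ^ 2 := by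
  -- the representations `d = γδ²`, `γ` squarefree (existence suffices)
  set S : Finset (ℕ × ℕ) := ((Icc 1 D ×ˢ Icc 1 D).filter fun p => Squarefree p.2) with hS
  have hcover : ∀ d ∈ Icc 1 D, (1 : ℝ) ≤ ∑ p ∈ S, if p.2 * p.1 ^ 2 = d then (1 : ℝ) else 0 := by
    intro d hd
    rw [mem_Icc] at hd
    obtain ⟨γ, δ, hγ0, hδ0, hgeq, hγ⟩ := Nat.sq_mul_squarefree_of_pos (by omega : 0 < d)
    have hmem : (δ, γ) ∈ S := by
      rw [hS, mem_filter, mem_product, mem_Icc, mem_Icc]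
      refine ⟨⟨⟨hδ0, ?_⟩, hγ0, ?_⟩, hγ⟩
      · calc δ ≤ δ ^ 2 * γ := by
              calc δ = δ * 1 * 1 := by ring
                _ ≤ δ * δ * γ := by gcongr <;> omega
                _ = δ ^ 2 * γ := by ring
          _ = d := hgeq
          _ ≤ D := hd.2
      · calc γ ≤ δ ^ 2 * γ := Nat.le_mul_of_pos_left γ (by positivity)
          _ = d := hgeq
          _ ≤ D := hd.2
    refine le_trans (le_of_eq ?_) (single_le_sum (f := fun p => if p.2 * p.1 ^ 2 = d then (1 : ℝ) else 0)
      (fun _ _ => by positivity) hmem)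
    simp only
    rw [if_pos (by rw [← hgeq]; ring)]
  calc ∑ d ∈ Icc 1 D, (#(fiRoots 0 d) : ℝ) / d
      ≤ ∑ d ∈ Icc 1 D, (∑ p ∈ S, if p.2 * p.1 ^ 2 = d then (1 : ℝ) else 0) *
          ((#(fiRoots 0 d) : ℝ) / d) :=
        sum_le_sum fun d hd => le_mul_of_one_le_left (by positivity) (hcover d hd)
    _ = ∑ p ∈ S, ∑ d ∈ Icc 1 D,
          (if p.2 * p.1 ^ 2 = d then (1 : ℝ) else 0) * ((#(fiRoots 0 d) : ℝ) / d) := by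
        simp_rw [sum_mul]; exact sum_comm
    _ ≤ ∑ p ∈ S, ((p.2 : ℝ)⁻¹ * (p.1 : ℝ)⁻¹) := by
        refine sum_le_sum fun p hp => ?_
        rw [hS, mem_filter, mem_product, mem_Icc, mem_Icc] at hp
        obtain ⟨⟨⟨hδ1, -⟩, hγ1, -⟩, hγ⟩ := hp
        -- at most the single term `d = γδ²`
        calc ∑ d ∈ Icc 1 D, (if p.2 * p.1 ^ 2 = d then (1 : ℝ) else 0) * ((#(fiRoots 0 d) : ℝ) / d)
            = ∑ d ∈ Icc 1 D, if p.2 * p.1 ^ 2 = d then (#(fiRoots 0 (p.2 * p.1 ^ 2)) : ℝ) /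
                ((p.2 * p.1 ^ 2 : ℕ) : ℝ) else 0 := by
              refine sum_congr rfl fun d _ => ?_
              split_ifs with h
              · subst h; rw [one_mul]
              · rw [zero_mul]
          _ ≤ (#(fiRoots 0 (p.2 * p.1 ^ 2)) : ℝ) / ((p.2 * p.1 ^ 2 : ℕ) : ℝ) := by
              rw [← sum_filter]
              rcases (filter (fun d => p.2 * p.1 ^ 2 = d) (Icc 1 D)).eq_empty_or_nonempty with h | h
              · rw [h, sum_empty]; positivity
              · have hsub : filter (fun d => p.2 * p.1 ^ 2 = d) (Icc 1 D) = {p.2 * p.1 ^ 2} := by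
                  refine eq_singleton_iff_unique_mem.mpr ⟨?_, fun d hd => ((mem_filter.mp hd).2).symm⟩
                  obtain ⟨d, hd⟩ := h
                  have := (mem_filter.mp hd).2
                  rw [← this] at hd
                  exact hd
                rw [hsub, sum_singleton]
          _ = ((p.2 : ℝ)⁻¹ * (p.1 : ℝ)⁻¹) := by
              rw [card_fiRoots_zero hγ hγ1 hδ1]
              have : (p.1 : ℝ) ≠ 0 := by exact_mod_cast (show p.1 ≠ 0 by omega)
              have : (p.2 : ℝ) ≠ 0 := by exact_mod_cast (show p.2 ≠ 0 by omega)
              push_cast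
              field_simp
    _ ≤ ∑ p ∈ Icc 1 D ×ˢ Icc 1 D, ((p.2 : ℝ)⁻¹ * (p.1 : ℝ)⁻¹) :=
        sum_le_sum_of_subset_of_nonneg (filter_subset _ _) fun _ _ _ => by positivity
    _ = (∑ m ∈ Icc 1 D, (m : ℝ)⁻¹) ^ 2 := by
        rw [sum_product, sq, sum_mul_sum]
        refine sum_congr rfl fun δ _ => sum_congr rfl fun γ _ => ?_
        ring
    _ ≤ (1 + Real.log D) ^ 2 :=
        pow_le_pow_left₀ (sum_nonneg fun _ _ => by positivity) (by
            have h : ∑ m ∈ Icc 1 D, (m : ℝ)⁻¹ = (harmonic D : ℝ) := by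
              rw [harmonic_eq_sum_Icc]; push_cast; rfl
            rw [h]; exact harmonic_le_one_add_log D) 2

/-- **`∑_{d ≤ D} ρ(ℓ; d)/d ≤ C τ(ℓ²) (1 + log D)²` for `ℓ ≥ 1`** ("`∑_{d ≤ D} d⁻¹ρ(c²; d) ≪ (log 2D)²`"):
group `d` by `g = (d, ℓ²) = γδ²`; then `d = gd'` with `(d', γℓ') = 1`, `ρ(ℓ; d) = δρ(d')` and
`δ/g = 1/(γδ) ≤ g^{-1/2} ≤ 1`, while `∑_{d' ≤ D} ρ(d')/d' ≤ C ∑ τ(d')/d' ≤ C (1 + log D)²`.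
[cite: FriedlanderIwaniecAnnals1998, §3, display before (3.12)] -/
theorem sum_card_fiRoots_div_le {C : ℕ} (hC : ∀ n, n ≠ 0 → fiRho n ≤ C * #n.divisors) {ℓ : ℕ}
    (hℓ : 0 < ℓ) (D : ℕ) :
    ∑ d ∈ Icc 1 D, (#(fiRoots ℓ d) : ℝ) / d ≤ C * #(ℓ ^ 2).divisors * (1 + Real.log D) ^ 2 := by
  have hℓ2 : ℓ ^ 2 ≠ 0 := pow_ne_zero 2 hℓ.ne'
  have hlog := one_add_log_nonneg D
  -- fibre over `g = (d, ℓ²)`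
  rw [← sum_fiberwise_of_maps_to (g := fun d => Nat.gcd d (ℓ ^ 2)) (t := (ℓ ^ 2).divisors)
    (fun d _ => Nat.mem_divisors.mpr ⟨Nat.gcd_dvd_right _ _, hℓ2⟩)]
  have hfib : ∀ g ∈ (ℓ ^ 2).divisors,
      ∑ d ∈ (Icc 1 D).filter (fun d => Nat.gcd d (ℓ ^ 2) = g), (#(fiRoots ℓ d) : ℝ) / d ≤
        C * (1 + Real.log D) ^ 2 := by
    intro g hg
    have hg0 : 0 < g := Nat.pos_of_mem_divisors hg
    obtain ⟨γ, δ, hγ0, hδ0, hgeq, hγ⟩ := Nat.sq_mul_squarefree_of_pos hg0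
    have hg' : g = γ * δ ^ 2 := by rw [← hgeq]; ring
    subst hg'
    have hγδ0 : 0 < γ * δ := Nat.mul_pos hγ0 hδ0
    -- the fibre consists of multiples `d = g d'`; bound termwise and extend to all multiples
    calc ∑ d ∈ (Icc 1 D).filter (fun d => Nat.gcd d (ℓ ^ 2) = γ * δ ^ 2), (#(fiRoots ℓ d) : ℝ) / d
        ≤ ∑ d ∈ (Icc 1 D).filter (fun d => Nat.gcd d (ℓ ^ 2) = γ * δ ^ 2),
            (C : ℝ) * #(d / (γ * δ ^ 2)).divisors / (d / (γ * δ ^ 2) : ℕ) := by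
          refine sum_le_sum fun d hd => ?_
          obtain ⟨hd1, hgcd⟩ := mem_filter.mp hd
          rw [mem_Icc] at hd1
          have hgd : γ * δ ^ 2 ∣ d := hgcd ▸ Nat.gcd_dvd_left _ _
          obtain ⟨d', rfl⟩ := hgd
          have hd'0 : 0 < d' := by
            rcases Nat.eq_zero_or_pos d' with rfl | h
            · simp at hd1
            · exact h
          rw [Nat.mul_div_cancel_left d' (by positivity)]
          obtain ⟨hγδℓ, hcop⟩ := (gcd_eq_mul_sq_iff hγ hγ0 hδ0).mp hgcd
          obtain ⟨ℓ', rfl⟩ := hγδℓ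
          rw [Nat.mul_div_cancel_left ℓ' hγδ0] at hcop
          have hcopγ : Nat.Coprime d' γ := Nat.Coprime.coprime_dvd_right (dvd_mul_right γ ℓ') hcop
          have hcopℓ : Nat.Coprime d' ℓ' := Nat.Coprime.coprime_dvd_right (dvd_mul_left ℓ' γ) hcop
          rw [card_fiRoots_factor hγ hγ0 hδ0 hcopγ, card_fiRoots_eq_fiRho hd'0 hcopℓ]
          have hρ : (fiRho d' : ℝ) ≤ C * #d'.divisors := by exact_mod_cast hC d' hd'0.ne'
          have hδle : (δ : ℝ) ≤ ((γ * δ ^ 2 : ℕ) : ℝ) := by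
            exact_mod_cast (show δ ≤ γ * δ ^ 2 by
              calc δ = 1 * (δ * 1) := by ring
                _ ≤ γ * (δ * δ) := by gcongr <;> omega
                _ = γ * δ ^ 2 := by ring)
          rw [div_le_div_iff₀ (by positivity) (by positivity)]
          push_cast
          calc (δ : ℝ) * (fiRho d' : ℝ) * (d' : ℝ) ≤ δ * (C * #d'.divisors) * d' := by gcongr
            _ ≤ ((γ : ℝ) * δ ^ 2) * (C * #d'.divisors) * d' := by
                push_cast at hδle
                gcongr
            _ = C * #d'.divisors * ((γ : ℝ) * δ ^ 2 * d') := by ring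
      _ ≤ ∑ d ∈ (Icc 1 D).filter (fun d => γ * δ ^ 2 ∣ d),
            (C : ℝ) * #(d / (γ * δ ^ 2)).divisors / (d / (γ * δ ^ 2) : ℕ) :=
          sum_le_sum_of_subset_of_nonneg
            (fun d hd => mem_filter.mpr ⟨(mem_filter.mp hd).1,
              (mem_filter.mp hd).2 ▸ Nat.gcd_dvd_left _ _⟩)
            fun _ _ _ => by positivity
      _ = ∑ d' ∈ Icc 1 (D / (γ * δ ^ 2)), (C : ℝ) * #d'.divisors / d' := by
          rw [sum_filter_dvd_Icc (by positivity)]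
          refine sum_congr rfl fun d' _ => ?_
          rw [Nat.mul_div_cancel_left d' (by positivity)]
      _ ≤ ∑ d' ∈ Icc 1 D, (C : ℝ) * #d'.divisors / d' :=
          sum_le_sum_of_subset_of_nonneg (Icc_subset_Icc_right (Nat.div_le_self _ _))
            fun _ _ _ => by positivity
      _ = C * ∑ d' ∈ Icc 1 D, (#d'.divisors : ℝ) / d' := by
          rw [mul_sum]; exact sum_congr rfl fun _ _ => by ring
      _ ≤ C * (1 + Real.log D) ^ 2 :=
          mul_le_mul_of_nonneg_left (sum_card_divisors_div_le D) (Nat.cast_nonneg C)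
  calc ∑ g ∈ (ℓ ^ 2).divisors, ∑ d ∈ (Icc 1 D).filter (fun d => Nat.gcd d (ℓ ^ 2) = g),
        (#(fiRoots ℓ d) : ℝ) / d
      ≤ ∑ g ∈ (ℓ ^ 2).divisors, (C : ℝ) * (1 + Real.log D) ^ 2 := sum_le_sum hfib
    _ = C * #(ℓ ^ 2).divisors * (1 + Real.log D) ^ 2 := by
        rw [sum_const, nsmul_eq_mul]; ring

/-! ### The lattice points in the strip `x - y < a² + c⁴ ≤ x` -/

/-- `κ = ∫₀¹ (1 - t⁴)^{1/2} dt ≤ 1`. [folklore] -/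
theorem friedlanderIwaniecKappa_le_one : friedlanderIwaniecKappa ≤ 1 := by
  unfold friedlanderIwaniecKappa
  have h : ∫ t in (0 : ℝ)..1, Real.sqrt (1 - t ^ 4) ≤ ∫ _ in (0 : ℝ)..1, (1 : ℝ) := by
    refine intervalIntegral.integral_mono_on zero_le_one ?_ ?_ fun t ht => ?_
    · exact ((continuous_const.sub (continuous_pow 4)).sqrt).intervalIntegrable _ _
    · exact intervalIntegrable_const
    · rw [Real.sqrt_le_one]
      have : 0 ≤ t ^ 4 := by positivity
      linarith
  simpa using h

/-- The points of the disc `a² + c⁴ ≤ ⌊x⌋` with `a² + c⁴ ≤ ⌊x'⌋` (`x' ≤ x`) form the disc of radius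
`⌊x'⌋`. [folklore] -/
theorem filter_fiDisc_le_eq {x x' : ℝ} (hxx : x' ≤ x) :
    (fiDisc ⌊x⌋₊).filter (fun ac => ac.1 ^ 2 + ac.2 ^ 4 ≤ (⌊x'⌋₊ : ℤ)) = fiDisc ⌊x'⌋₊ := by
  have hN : ⌊x'⌋₊ ≤ ⌊x⌋₊ := Nat.floor_mono hxx
  ext ⟨a, c⟩
  simp only [fiDisc, mem_filter]
  constructor
  · rintro ⟨⟨-, -⟩, h⟩
    refine ⟨?_, h⟩
    have h0 : 0 ≤ a ^ 2 + c ^ 4 := by positivity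
    exact mem_fiBox_of_eq (n := (a ^ 2 + c ^ 4).toNat) (by rw [Int.toNat_of_nonneg h0])
      (Int.toNat_le.mpr h)
  · rintro ⟨-, h⟩
    have h0 : 0 ≤ a ^ 2 + c ^ 4 := by positivity
    have hle : a ^ 2 + c ^ 4 ≤ (⌊x⌋₊ : ℤ) := h.trans (by exact_mod_cast hN)
    exact ⟨⟨mem_fiBox_of_eq (n := (a ^ 2 + c ^ 4).toNat) (by rw [Int.toNat_of_nonneg h0])
      (Int.toNat_le.mpr hle), hle⟩, h⟩

/-- **The number of lattice points with `x - y < a² + c⁴ ≤ x` is `A(x) - A(x - y)`**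
(`0 ≤ y`). [cite: FriedlanderIwaniecAnnals1998, §3 (3.10)] -/
theorem card_strip_eq {x y : ℝ} (hy : 0 ≤ y) :
    (#((fiDisc ⌊x⌋₊).filter (fun ac => (⌊x - y⌋₊ : ℤ) < ac.1 ^ 2 + ac.2 ^ 4)) : ℝ) =
      fiCount x - fiCount (x - y) := by
  have hA : ∀ z : ℝ, fiCount z = #(fiDisc ⌊z⌋₊) - 1 := by
    intro z
    rw [fiCount, ← sum_fiRepCount_add_one]; push_cast; ring
  have hsplit := card_filter_add_card_filter_not (s := fiDisc ⌊x⌋₊)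
    (p := fun ac : ℤ × ℤ => ac.1 ^ 2 + ac.2 ^ 4 ≤ (⌊x - y⌋₊ : ℤ))
  rw [filter_fiDisc_le_eq (by linarith)] at hsplit
  have hneg : (fiDisc ⌊x⌋₊).filter (fun ac => ¬ ac.1 ^ 2 + ac.2 ^ 4 ≤ (⌊x - y⌋₊ : ℤ)) =
      (fiDisc ⌊x⌋₊).filter (fun ac => (⌊x - y⌋₊ : ℤ) < ac.1 ^ 2 + ac.2 ^ 4) :=
    filter_congr fun _ _ => not_le
  rw [hneg] at hsplit
  rw [hA x, hA (x - y)]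
  have := congrArg (fun n : ℕ => (n : ℝ)) hsplit
  push_cast at this
  linarith

/-- **The strip count** (the lattice-point input of (3.10) and (3.12)): for `1 ≤ x - y`,
`0 ≤ y`, `2y ≤ x`, the number of `(a, c) ∈ ℤ²` with `x - y < a² + c⁴ ≤ x` is at most
`4 y x^{-1/4} + 28 √x` (from `|A(t) - 4κt^{3/4}| ≤ 14√t` at `t = x, x - y`, `κ ≤ 1` and
`x^{3/4} - (x - y)^{3/4} ≤ (3/4)·2^{1/4} y x^{-1/4}`). [cite: FriedlanderIwaniecAnnals1998, §3 (3.10)] -/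
theorem strip_count_le {x y : ℝ} (hxy : 1 ≤ x - y) (hy : 0 ≤ y) (h2y : 2 * y ≤ x) :
    (#((fiDisc ⌊x⌋₊).filter (fun ac => (⌊x - y⌋₊ : ℤ) < ac.1 ^ 2 + ac.2 ^ 4)) : ℝ) ≤
      4 * y * x ^ (-(1 / 4 : ℝ)) + 28 * Real.sqrt x := by
  have hx1 : 1 ≤ x := by linarith
  have hx0 : 0 < x := by linarith
  have hu0 : 0 < x - y := by linarith
  rw [card_strip_eq hy]
  have h1 := abs_fiCount_sub_le hx1
  have h2 := abs_fiCount_sub_le hxy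
  rw [abs_le] at h1 h2
  have hκ0 := friedlanderIwaniecKappa_pos
  have hκ1 := friedlanderIwaniecKappa_le_one
  have hsqrt : Real.sqrt (x - y) ≤ Real.sqrt x := Real.sqrt_le_sqrt (by linarith)
  -- `x^{3/4} - (x-y)^{3/4} ≤ y x^{-1/4}`
  have hpow : x ^ (3 / 4 : ℝ) - (x - y) ^ (3 / 4 : ℝ) ≤ y * x ^ (-(1 / 4 : ℝ)) := by
    -- Bernoulli: `x^{3/4} = (x-y)^{3/4} (1 + y/(x-y))^{3/4} ≤ (x-y)^{3/4} (1 + (3/4) y/(x-y))`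
    have hB : (1 + y / (x - y)) ^ (3 / 4 : ℝ) ≤ 1 + 3 / 4 * (y / (x - y)) :=
      rpow_one_add_le_one_add_mul_self (by linarith [show 0 ≤ y / (x - y) by positivity])
        (by norm_num) (by norm_num)
    have hx34 : x ^ (3 / 4 : ℝ) = (x - y) ^ (3 / 4 : ℝ) * (1 + y / (x - y)) ^ (3 / 4 : ℝ) := by
      rw [← Real.mul_rpow hu0.le (by positivity)]
      congr 1
      field_simp
      ring
    -- `(x-y)^{3/4} · (3/4) y/(x-y) = (3/4) y (x-y)^{-1/4} ≤ (3/4) 2^{1/4} y x^{-1/4} ≤ y x^{-1/4}`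
    have hneg : (x - y) ^ (3 / 4 : ℝ) * (y / (x - y)) = y * (x - y) ^ (-(1 / 4 : ℝ)) := by
      rw [show (-(1 / 4 : ℝ)) = 3 / 4 - 1 by norm_num, Real.rpow_sub_one hu0.ne']
      ring
    have hcmp : (x - y) ^ (-(1 / 4 : ℝ)) ≤ (4 / 3) * x ^ (-(1 / 4 : ℝ)) := by
      -- `(x-y)^{-1/4} ≤ (x/2)^{-1/4} = 2^{1/4} x^{-1/4}` and `2^{1/4} ≤ 4/3`
      have hxy2 : x / 2 ≤ x - y := by linarith
      have e1 : (x - y) ^ (-(1 / 4 : ℝ)) ≤ (x / 2) ^ (-(1 / 4 : ℝ)) :=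
        Real.rpow_le_rpow_of_nonpos (by positivity) hxy2 (by norm_num)
      have e2 : (x / 2) ^ (-(1 / 4 : ℝ)) = (2 : ℝ) ^ (1 / 4 : ℝ) * x ^ (-(1 / 4 : ℝ)) := by
        rw [Real.div_rpow hx0.le (by norm_num), Real.rpow_neg (by norm_num : (0:ℝ) ≤ 2) (1 / 4),
          div_inv_eq_mul, mul_comm]
      have e3 : (2 : ℝ) ^ (1 / 4 : ℝ) ≤ 4 / 3 := by
        have h4 : ((2 : ℝ) ^ (1 / 4 : ℝ)) ^ (4 : ℕ) = 2 := by
          rw [← Real.rpow_natCast, ← Real.rpow_mul (by norm_num)]; norm_num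
        by_contra hlt
        rw [not_le] at hlt
        have := pow_lt_pow_left₀ hlt (by norm_num) (four_ne_zero)
        rw [h4] at this
        norm_num at this
      calc (x - y) ^ (-(1 / 4 : ℝ)) ≤ (x / 2) ^ (-(1 / 4 : ℝ)) := e1
        _ = (2 : ℝ) ^ (1 / 4 : ℝ) * x ^ (-(1 / 4 : ℝ)) := e2
        _ ≤ 4 / 3 * x ^ (-(1 / 4 : ℝ)) := by gcongr
    have hu34 : 0 ≤ (x - y) ^ (3 / 4 : ℝ) := by positivity
    calc x ^ (3 / 4 : ℝ) - (x - y) ^ (3 / 4 : ℝ)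
        = (x - y) ^ (3 / 4 : ℝ) * ((1 + y / (x - y)) ^ (3 / 4 : ℝ) - 1) := by rw [hx34]; ring
      _ ≤ (x - y) ^ (3 / 4 : ℝ) * (3 / 4 * (y / (x - y))) :=
          mul_le_mul_of_nonneg_left (by linarith) hu34
      _ = 3 / 4 * (y * (x - y) ^ (-(1 / 4 : ℝ))) := by rw [← hneg]; ring
      _ ≤ 3 / 4 * (y * ((4 / 3) * x ^ (-(1 / 4 : ℝ)))) := by gcongr
      _ = y * x ^ (-(1 / 4 : ℝ)) := by ring
  have hκpow : 4 * friedlanderIwaniecKappa * (x ^ (3 / 4 : ℝ) - (x - y) ^ (3 / 4 : ℝ)) ≤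
      4 * 1 * (y * x ^ (-(1 / 4 : ℝ))) := by
    have : 0 ≤ x ^ (3 / 4 : ℝ) - (x - y) ^ (3 / 4 : ℝ) :=
      sub_nonneg.mpr (Real.rpow_le_rpow hu0.le (by linarith) (by norm_num))
    gcongr
  nlinarith [Real.sqrt_nonneg (x - y), Real.sqrt_nonneg x]

end Literature.NumberTheory.Sieve.FriedlanderIwaniecPrimes
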